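import Summits.NavierStokesRegularity.NavierStokesRegularity.Theses.SelfMixingDichotomy
import Summits.NavierStokesRegularity.NavierStokesRegularity.Theorems.SelfMixingDichotomyCoherentScaleExclusionFloors
import Summits.NavierStokesRegularity.NavierStokesRegularity.Theorems.SelfMixingDichotomyCoherentScaleExclusionTypeICoherence
import HarnessLib

/-!
# Crux `CoherentScaleExclusion` (stmt-NavierStokesRegularity-1423), line `registered`:
# the structure cruxes S1 ∧ S2 as ONE non-mixing exclusion statement; the Type-I price of S2

Support file (`--supports stmt-NavierStokesRegularity-1423`, lead c1 of the line; pure logic over the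
landed floors). Route `SelfMixingDichotomy` has two structure cruxes about a standing Navier–Stokes
solution (`ν = 1`, classical on `[0,T)`, Leray–Hopf, rapidly decaying datum) at a final-time point
`(T, x₀)`, both concluding local boundedness BDD:

* S1 `SequentialTypeIExclusion`: recurrent bounded-load scales (`cknC r_k ≤ M`, `r_k → 0`) ⇒ BDD;
* S2 `CoherentScaleExclusion` (this crux): `∀ δ > 0 ∃ M`, recurrent loaded (`cknC r_k ≥ M`) AND
  non-`δ`-mixing (`¬ MIX(u,T,x₀,r_k,δ)`) scales ⇒ BDD.

With the LOAD FLOOR of `…CoherentScaleExclusionFloors` (recurrent bounded-load scales force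
recurrent non-`δ₁(M)`-mixing scales) the load parameter drops out of the pair:

* `sequentialTypeIExclusion_and_coherentScaleExclusion_iff` — **S1 ∧ S2 ⇔ NME**, where
  NME ("non-mixing exclusion") := for every `δ > 0`, every final-time point of a standing solution
  at which non-`δ`-mixing scales recur (`¬ MIX(u,T,x₀,r_k,δ)` along some `r_k → 0`) is a point
  near which `u` is bounded. So the route's thesis `MixingPayoff ∧ S2 ∧ S1` is, up to logic,
  `MixingPayoff ∧ NME`: a pure DICHOTOMY cofinitely-`δ`-mixing / recurrently-non-`δ`-mixing, the
  local Reynolds number `cknC` playing no role (information for the tenure planner: S1 and S2 can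
  be merged; only NME at the `δ` of `MixingPayoff` is ever used by the deciding theorem `closes`).

With the TYPE-I COHERENCE of `…CoherentScaleExclusionTypeICoherence` (at an `L∞`-Type-I(K)
point the drift is non-`δ`-mixing at ALL small scales for `δ ≤ δ₁(K)`, from the landed
well-posedness and bounded-drift floor of the sibling line on `MixingPayoff`) the price of S2 at
small `δ` becomes visible:

* `coherentScaleExclusion_bdd_of_typeI` — S2 alone bars every LOADED `L∞`-Type-I(K) blow-up of a
  standing solution (`δ ≤ δ₁(K)`: coherence is automatic there, so S2 says
  `limsup_{r→0} cknC r ≥ M(δ) ⇒ BDD` at Type-I(K) points);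
* `bdd_of_typeI_of_sequentialTypeIExclusion_of_coherentScaleExclusion` — S1 ∧ S2 bar EVERY
  `L∞`-Type-I(K) blow-up of a standing solution, for every `K` (the lightly loaded Type-I points
  go to S1).

Everything is unconditional where no route decl appears as a hypothesis (standard axioms); no
definitions, no named facts.
-/

noncomputable section

-- `Summit = Problem` for this summit; the tree lakefile sets `weak.linter.dupNamespace = false`.
set_option linter.dupNamespace false

namespace Summit.NavierStokesRegularity.NavierStokesRegularity.Theorems

open MeasureTheory Set Metric
open Literature.Analysis.FluidPDE
open Summit.NavierStokesRegularity.NavierStokesRegularity.Theses.SelfMixingDichotomy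

/-! ### S1 ∧ S2 ⇔ non-mixing exclusion -/

/-- **The two structure cruxes of route `SelfMixingDichotomy` are ONE statement without the load
parameter: S1 ∧ S2 ⇔ NME.** Here NME says: for every `δ > 0`, at every final-time point `(T, x₀)`
of a standing Navier–Stokes solution where non-`δ`-mixing scales recur
(`¬ DissipatesAtScale u T x₀ r_k δ` along some `r_k → 0`), `u` is bounded near `(T, x₀)`.
(⇒) is the logic of the route's deciding theorem: with `M = M_{S2}(δ)`, either loaded non-mixing
scales recur (S2) or the non-mixing scales are eventually lightly loaded (S1 at `M`). (⇐) S2 is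
NME with the load hypothesis dropped (`M := 0`); S1 at threshold `M` follows from NME at
`δ₁(max M 1)` through the load floor `coherentScaleExclusion_notMix_recur_of_load_recur`
(recurrent bounded-load scales force recurrent non-`δ₁`-mixing scales). -/
theorem sequentialTypeIExclusion_and_coherentScaleExclusion_iff : (Summit.NavierStokesRegularity.NavierStokesRegularity.Theses.SelfMixingDichotomy.SequentialTypeIExclusion ∧ Summit.NavierStokesRegularity.NavierStokesRegularity.Theses.SelfMixingDichotomy.CoherentScaleExclusion) ↔ (∀ δ : ℝ, 0 < δ → ∀ T : ℝ, 0 < T → ∀ (u : ℝ → EuclideanSpace ℝ (Fin 3) → EuclideanSpace ℝ (Fin 3)) (p : ℝ → EuclideanSpace ℝ (Fin 3) → ℝ), Literature.Analysis.FluidPDE.IsClassicalNSSolutionOn (Set.Ico 0 T) 1 0 u p → Literature.Analysis.FluidPDE.IsLerayHopfOn T 1 0 (u 0) u → Literature.Analysis.FluidPDE.HasRapidSpatialDecay (u 0) → ∀ x₀ : EuclideanSpace ℝ (Fin 3), (∀ r₀ : ℝ, 0 < r₀ → ∃ r ∈ Set.Ioo 0 r₀, ¬ Literature.Analysis.FluidPDE.DissipatesAtScale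 u T x₀ r δ) → (∃ ρ : ℝ, 0 < ρ ∧ ∃ M : ℝ, ∀ t ∈ Set.Ioo (T - ρ ^ 2) T, ∀ x ∈ Metric.ball x₀ ρ, ‖u t x‖ ≤ M)) := by
  constructor
  · rintro ⟨hS1, hS2⟩ δ hδ T hT u p hcl hLH hdec x₀ hrec
    by_contra hnb
    obtain ⟨M, hM⟩ := hS2 δ hδ
    -- S1 at threshold `M`: if bounded-load scales recurred, `u` would be bounded near `(T, x₀)`
    have hnot : ¬ ∀ r₀ : ℝ, 0 < r₀ → ∃ r ∈ Set.Ioo 0 r₀,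
        cknC r ((T, x₀) : ℝ × EuclideanSpace ℝ (Fin 3)) u ≤ ENNReal.ofReal M :=
      fun h => hnb (hS1 M T hT u p hcl hLH hdec x₀ h)
    push Not at hnot
    obtain ⟨r₁, hr₁, hload⟩ := hnot
    -- so every scale below `r₁` is loaded, and the non-mixing scales below `min r₀ r₁` feed S2
    refine hnb (hM T hT u p hcl hLH hdec x₀ fun r₀ hr₀ => ?_)
    obtain ⟨r, hr, hnm⟩ := hrec (min r₀ r₁) (lt_min hr₀ hr₁)
    exact ⟨r, ⟨hr.1, lt_of_lt_of_le hr.2 (min_le_left _ _)⟩,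
      (hload r ⟨hr.1, lt_of_lt_of_le hr.2 (min_le_right _ _)⟩).le, hnm⟩
  · intro hN
    refine ⟨fun M T hT u p hcl hLH hdec x₀ hlow => ?_, fun δ hδ => ⟨0, fun T hT u p hcl hLH hdec x₀ hRec => ?_⟩⟩
    · -- S1: recurrent load `≤ M ≤ max M 1` forces recurrent non-`δ₁`-mixing (load floor), then NME
      have hM₁ : 0 < max M 1 := lt_of_lt_of_le one_pos (le_max_right _ _)
      obtain ⟨δ₁, hδ₁, hbr⟩ := coherentScaleExclusion_notMix_recur_of_load_recur (max M 1) hM₁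
      exact hN δ₁ hδ₁ T hT u p hcl hLH hdec x₀
        (hbr T hT u p hcl hLH hdec x₀ fun r₀ hr₀ => (hlow r₀ hr₀).imp fun _ hr =>
          ⟨hr.1, hr.2.trans (ENNReal.ofReal_le_ofReal (le_max_left _ _))⟩)
    · -- S2 with threshold `0`: drop the load hypothesis
      exact hN δ hδ T hT u p hcl hLH hdec x₀ fun r₀ hr₀ => (hRec r₀ hr₀).imp fun _ hr => ⟨hr.1, hr.2.2⟩

/-- **Non-mixing exclusion implies the crux** (the easy half of the merger, recorded separately):
if for some `δ > 0` recurrently non-`δ`-mixing final-time points of standing solutions are points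
of local boundedness, then `CoherentScaleExclusion` holds AT THAT `δ` with threshold `M = 0`. -/
theorem coherentScaleExclusion_at_of_nonMixingExclusion_at {δ : ℝ}
    (hN : ∀ T : ℝ, 0 < T → ∀ (u : ℝ → EuclideanSpace ℝ (Fin 3) → EuclideanSpace ℝ (Fin 3))
      (p : ℝ → EuclideanSpace ℝ (Fin 3) → ℝ),
      IsClassicalNSSolutionOn (Set.Ico 0 T) 1 0 u p → IsLerayHopfOn T 1 0 (u 0) u →
      HasRapidSpatialDecay (u 0) → ∀ x₀ : EuclideanSpace ℝ (Fin 3),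
      (∀ r₀ : ℝ, 0 < r₀ → ∃ r ∈ Set.Ioo 0 r₀, ¬ DissipatesAtScale u T x₀ r δ) →
      (∃ ρ : ℝ, 0 < ρ ∧ ∃ M : ℝ, ∀ t ∈ Set.Ioo (T - ρ ^ 2) T, ∀ x ∈ Metric.ball x₀ ρ, ‖u t x‖ ≤ M)) :
    ∃ M : ℝ, ∀ T : ℝ, 0 < T → ∀ (u : ℝ → EuclideanSpace ℝ (Fin 3) → EuclideanSpace ℝ (Fin 3)) (p : ℝ → EuclideanSpace ℝ (Fin 3) → ℝ), Literature.Analysis.FluidPDE.IsClassicalNSSolutionOn (Set.Ico 0 T) 1 0 u p → Literature.Analysis.FluidPDE.IsLerayHopfOn T 1 0 (u 0) u → Literature.Analysis.FluidPDE.HasRapidSpatialDecay (u 0) → ∀ x₀ : EuclideanSpace ℝ (Fin 3), (∀ r₀ : ℝ, 0 < r₀ → ∃ r ∈ Set.Ioo 0 r₀, ENNReal.ofReal M ≤ Literature.Analysis.FluidPDE.cknC r ((T, x₀) : ℝ × EuclideanSpace ℝ (Fin 3)) u ∧ ¬ (∀ θ : ℝ → EuclideanSpace ℝ (Fin 3)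 → ℝ, Literature.Analysis.FluidPDE.IsSmoothSpaceTimeOn (Set.Icc (T - r ^ 2) (T - r ^ 2 / 2)) θ → Literature.Analysis.FluidPDE.HasUniformRapidDecayOn (Set.Icc (T - r ^ 2) (T - r ^ 2 / 2)) θ → (∀ t ∈ (Set.Icc (T - r ^ 2) (T - r ^ 2 / 2)), ∀ x : EuclideanSpace ℝ (Fin 3), Literature.Analysis.FluidPDE.timeDerivWithin (Set.Icc (T - r ^ 2) (T - r ^ 2 / 2)) θ t x + inner ℝ (u t x) (gradient (θ t) x) = Laplacian.laplacian (θ t) x) → Function.support (θ (T - r ^ 2)) ⊆ Metric.ball x₀ r → ∫ x, (θ (T - r ^ 2 / 2) x) ^ 2 ≤ δ ^ 2 * ∫ x, (θ (T - r ^ 2) x) ^ 2)) → (∃ ρ : ℝ, 0 < ρ ∧ ∃ M : ℝ, ∀ t ∈ Set.Ioo (T - ρ ^ 2) T, ∀ x ∈ Metric.ball x₀ ρ, ‖u t x‖ ≤ M) :=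
  ⟨0, fun T hT u p hcl hLH hdec x₀ hRec =>
    hN T hT u p hcl hLH hdec x₀ fun r₀ hr₀ => (hRec r₀ hr₀).imp fun _ hr => ⟨hr.1, hr.2.2⟩⟩

/-! ### The Type-I price of S2 -/

/-- **S2 bars loaded `L∞`-Type-I blow-up (coherence is automatic there).** Assume
`CoherentScaleExclusion`. For every `K > 0` there is `δ₁ = δ₁(K) > 0` (the Type-I coherence level
of `stub_typeICoherence`) such that for every `0 < δ ≤ δ₁`, with `M = M_{S2}(δ)`: at a final-time
point `(T, x₀)` of a standing solution obeying the Type-I(K) bound `√(T − t)‖u(t,x)‖ ≤ K` on a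
parabolic cylinder at `(T, x₀)`, recurrent LOADED scales alone (`cknC r_k ≥ M` along `r_k → 0`)
force local boundedness — the non-mixing half of the antecedent of S2 holds at every small scale. -/
theorem coherentScaleExclusion_bdd_of_typeI (hS2 : CoherentScaleExclusion) :
    ∀ K : ℝ, 0 < K → ∃ δ₁ : ℝ, 0 < δ₁ ∧ ∀ δ : ℝ, 0 < δ → δ ≤ δ₁ → ∃ M : ℝ, ∀ T : ℝ, 0 < T →
      ∀ (u : ℝ → EuclideanSpace ℝ (Fin 3) → EuclideanSpace ℝ (Fin 3)) (p : ℝ → EuclideanSpace ℝ (Fin 3) → ℝ),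
      IsClassicalNSSolutionOn (Set.Ico 0 T) 1 0 u p → IsLerayHopfOn T 1 0 (u 0) u →
      HasRapidSpatialDecay (u 0) → ∀ x₀ : EuclideanSpace ℝ (Fin 3),
      (∃ r₁ : ℝ, 0 < r₁ ∧ ∀ t ∈ Set.Ioo (T - r₁ ^ 2) T, ∀ x ∈ Metric.ball x₀ r₁,
        Real.sqrt (T - t) * ‖u t x‖ ≤ K) →
      (∀ r₀ : ℝ, 0 < r₀ → ∃ r ∈ Set.Ioo 0 r₀,
        ENNReal.ofReal M ≤ cknC r ((T, x₀) : ℝ × EuclideanSpace ℝ (Fin 3)) u) →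
      ∃ ρ : ℝ, 0 < ρ ∧ ∃ M : ℝ, ∀ t ∈ Set.Ioo (T - ρ ^ 2) T, ∀ x ∈ Metric.ball x₀ ρ, ‖u t x‖ ≤ M := by
  intro K hK
  obtain ⟨δ₁, hδ₁, hcoh⟩ := stub_typeICoherence K hK
  refine ⟨δ₁, hδ₁, fun δ hδ hδδ₁ => ?_⟩
  obtain ⟨M, hM⟩ := hS2 δ hδ
  refine ⟨M, fun T hT u p hcl hLH hdec x₀ hTI hload => ?_⟩
  obtain ⟨r₂, hr₂, hnm⟩ := hcoh T hT u p hcl hLH hdec x₀ hTI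
  refine hM T hT u p hcl hLH hdec x₀ fun r₀ hr₀ => ?_
  obtain ⟨r, hr, hMr⟩ := hload (min r₀ r₂) (lt_min hr₀ hr₂)
  exact ⟨r, ⟨hr.1, lt_of_lt_of_le hr.2 (min_le_left _ _)⟩, hMr,
    hnm r ⟨hr.1, lt_of_lt_of_le hr.2 (min_le_right _ _)⟩ δ hδ.le hδδ₁⟩

/-- **S1 ∧ S2 bar every `L∞`-Type-I blow-up of a standing solution.** Assume
`SequentialTypeIExclusion` and `CoherentScaleExclusion`. Then for every `K > 0`, at every
final-time point `(T, x₀)` of a standing Navier–Stokes solution obeying the Type-I(K) bound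
`√(T − t)‖u(t,x)‖ ≤ K` on some parabolic cylinder at `(T, x₀)`, `u` is bounded near `(T, x₀)`:
with `δ₁ = δ₁(K)` and `M = M_{S2}(δ₁)`, either loaded scales recur (previous theorem) or bounded-load
scales recur (S1 at `M`). So the two structure cruxes of the route already contain Type-I exclusion
for standing solutions. -/
theorem bdd_of_typeI_of_sequentialTypeIExclusion_of_coherentScaleExclusion
    (hS1 : SequentialTypeIExclusion) (hS2 : CoherentScaleExclusion) :
    ∀ K : ℝ, 0 < K → ∀ T : ℝ, 0 < T →
      ∀ (u : ℝ → EuclideanSpace ℝ (Fin 3) → EuclideanSpace ℝ (Fin 3)) (p : ℝ → EuclideanSpace ℝ (Fin 3) → ℝ),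
      IsClassicalNSSolutionOn (Set.Ico 0 T) 1 0 u p → IsLerayHopfOn T 1 0 (u 0) u →
      HasRapidSpatialDecay (u 0) → ∀ x₀ : EuclideanSpace ℝ (Fin 3),
      (∃ r₁ : ℝ, 0 < r₁ ∧ ∀ t ∈ Set.Ioo (T - r₁ ^ 2) T, ∀ x ∈ Metric.ball x₀ r₁,
        Real.sqrt (T - t) * ‖u t x‖ ≤ K) →
      ∃ ρ : ℝ, 0 < ρ ∧ ∃ M : ℝ, ∀ t ∈ Set.Ioo (T - ρ ^ 2) T, ∀ x ∈ Metric.ball x₀ ρ, ‖u t x‖ ≤ M := by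
  intro K hK T hT u p hcl hLH hdec x₀ hTI
  obtain ⟨δ₁, hδ₁, hδ⟩ := coherentScaleExclusion_bdd_of_typeI hS2 K hK
  obtain ⟨M, hM⟩ := hδ δ₁ hδ₁ le_rfl
  by_cases hload : ∀ r₀ : ℝ, 0 < r₀ → ∃ r ∈ Set.Ioo 0 r₀,
      ENNReal.ofReal M ≤ cknC r ((T, x₀) : ℝ × EuclideanSpace ℝ (Fin 3)) u
  · exact hM T hT u p hcl hLH hdec x₀ hTI hload
  · push Not at hload
    obtain ⟨r₁, hr₁, hlow⟩ := hload
    refine hS1 M T hT u p hcl hLH hdec x₀ fun r₀ hr₀ => ?_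
    refine ⟨min r₀ r₁ / 2, ⟨by positivity, ?_⟩, (hlow _ ⟨by positivity, ?_⟩).le⟩
    · have := min_le_left r₀ r₁; linarith [lt_min hr₀ hr₁]
    · have := min_le_right r₀ r₁; linarith [lt_min hr₀ hr₁]

end Summit.NavierStokesRegularity.NavierStokesRegularity.Theorems

end
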